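import Literature.NumberTheory.Automorphic.FiniteAdeleSchwartzBruhatTensor
import HarnessLib

/-!
# Transport of a restricted tensor product structure along a linear isomorphism of the ambient module

Topic `NumberTheory/Automorphic`; namespace `Literature.NumberTheory.Automorphic`.  Flath's restricted tensor product
`(W, j) ≅ ⊗'_i (V i, x₀ i)` ([Flath 1979, §2]; Bump §3.4) in the tree's predicate form ★ `IsRestrictedTensorProduct k j S₀` /
★ `IsRestrictedTensorProductRep ρ π hx₀ j S₀` is a universal property, hence invariant under isomorphisms of the target:
if `e : W ≃ₗ[k] W'` then `(W', e ∘ j)` is again a restricted tensor product, and if `e` intertwines `π` with `π'` then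
`π' ≅ ⊗'_i ρ i` through `e ∘ j`.  (Convenience glue for consumers holding a representation only up to an intertwining
isomorphism — e.g. the cell `hodgecm-mathlib`'s d6 line S4c-2, where `ω⋆` is identified with a coinvariant representation
whose `⊗'`-certificate is ★ `omegaPi_centralCoinv`.)

The module-level transport ★ `IsRestrictedTensorProduct.comp_linearEquiv` (`FiniteAdeleSchwartzBruhatTensor`) is in the tree;
this file adds the EQUIVARIANT version:

* `IsRestrictedTensorProductRep.comp_linearEquiv` — along an intertwining `e : W ≃ₗ[k] W'` (`e (π g w) = π' g (e w)`),
  `(π', W', e ∘ j) ≅ ⊗'_i (ρ i, x₀ i)`;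
* `IsRestrictedTensorProductRep.comp_linearEquiv'` — the same with the intertwining stated as `e ∘ₗ π g = π' g ∘ₗ e`.

## References
* D. Flath, *Decomposition of representations into tensor products*, Corvallis 1979, part 1, §2 [Flath1979].
* D. Bump, *Automorphic Forms and Representations* (1997), §3.4 [Bump1997].
-/

open scoped RestrictedProduct
open Filter

namespace Literature.NumberTheory.Automorphic

universe u uk uG v w w'


section Rep

variable {ι : Type u} {k : Type uk} [CommRing k] {G : ι → Type uG} [∀ i, Group (G i)]
  {K : ∀ i, Subgroup (G i)} {V : ι → Type v} [∀ i, AddCommGroup (V i)] [∀ i, Module k (V i)]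
  {ρ : ∀ i, Representation k (G i) (V i)} {x₀ : ∀ i, V i} [DecidableEq ι]
  {W : Type w} [AddCommGroup W] [Module k W] {W' : Type w'} [AddCommGroup W'] [Module k W']
  {π : Representation k (Πʳ i, [G i, K i]) W} {hx₀ : ∀ᶠ i in cofinite, x₀ i ∈ (ρ i).fixedPoints (K i)}
  {j : RestrictedFamily V x₀ → W} {S₀ : Finset ι}

/-- **Transport of `π ≅ ⊗'_i ρ i` along an intertwining isomorphism.**  If `(π, W, j) ≅ ⊗'_i (ρ i, x₀ i)` and
`e : W ≃ₗ[k] W'` intertwines `π` with a representation `π'` on `W'` (`e (π g w) = π' g (e w)`), then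
`(π', W', e ∘ j) ≅ ⊗'_i (ρ i, x₀ i)` with the same exceptional set. [cite: Flath1979, §2 Example 2] -/
theorem IsRestrictedTensorProductRep.comp_linearEquiv (h : IsRestrictedTensorProductRep ρ π hx₀ j S₀)
    (e : W ≃ₗ[k] W') (π' : Representation k (Πʳ i, [G i, K i]) W') (he : ∀ (g : Πʳ i, [G i, K i]) (w : W),
      e (π g w) = π' g (e w)) :
    IsRestrictedTensorProductRep ρ π' hx₀ (e ∘ j) S₀ :=
  ⟨h.isRestrictedTensorProduct.comp_linearEquiv e, fun g x => by rw [Function.comp_apply, h.map_smul, he]; rfl⟩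

/-- The same for a `Representation.Equiv` packaged as a linear isomorphism with its intertwining property
(`e ∘ π g = π' g ∘ e` as linear maps). [cite: Flath1979, §2 Example 2] -/
theorem IsRestrictedTensorProductRep.comp_linearEquiv' (h : IsRestrictedTensorProductRep ρ π hx₀ j S₀)
    (e : W ≃ₗ[k] W') (π' : Representation k (Πʳ i, [G i, K i]) W')
    (he : ∀ g : Πʳ i, [G i, K i], e.toLinearMap ∘ₗ π g = π' g ∘ₗ e.toLinearMap) :
    IsRestrictedTensorProductRep ρ π' hx₀ (e ∘ j) S₀ :=
  h.comp_linearEquiv e π' fun g w => by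
    have := LinearMap.congr_fun (he g) w
    simpa only [LinearMap.coe_comp, Function.comp_apply, LinearEquiv.coe_coe] using this

end Rep

end Literature.NumberTheory.Automorphic
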